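import Summits.ResolutionOfSingularities.ResolutionOfSingularities.Theses.JacobianBudget
import Summits.ResolutionOfSingularities.ResolutionOfSingularities.Theorems.WildConesClassicalRegimesDefs
import HarnessLib

/-!
# Crux `IsolatedJacobianDrop` (stmt-ResolutionOfSingularities-18946) — line `euler-noether`,
# lead's skeleton v1 (2026-08-17)

Route `ResolutionOfSingularities/JacobianBudget`. The crux, BY NAME the route decl
`JacobianBudget.IsolatedJacobianDrop`: along the point-blow-up dynamics of a height-one atom
`z^p = a(u₁, …, uₙ)` over a perfect field of characteristic `p`, whenever two consecutive states are
ISOLATED of multiplicity `p`, the Jacobian colength `μ(a) = dim_κ κ[[u]] ⧸ (∂₁a, …, ∂ₙa)` drops by at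
least `Δ_n(p) = ((p-1)^n (p+1) - (-1)^n)/p`.

## Vocabulary (lead's reshape v1)

The crux's fourteen `let`s are VERBATIM the Theorems-side calculus of the sibling route `WildCones`
(`Theorems/WildConesClassicalRegimesDefs.lean`: `clean bl ord dv tr step run ser pd jac Isol MultP mu`,
explicit arguments `p n κ`), so this skeleton is written over that landed vocabulary: every stub below is
a statement over tree-resident names and can be landed under `Theorems/` before any new definition file
is reviewed, and the sibling cruxes' landed kits apply verbatim (`MuDropCurve.*` for `n = 1`,
`MuDropSurface.surfaceDict` for `n = 2`, `FrobeniusClosing.chartMap` / `NarrowRunsDie.stub_dict` for the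
dictionary `σ_{i,τ}(ser c) = u_iᵖ · T`). The new vocabulary of the line (`Δ`, `form`, `excIdeal`,
`ExcFinite`, `pt`, `NF`, `locT`) is defined here and proposed separately as
`Theorems/JacobianBudgetDefs.lean`; when that lands this file imports it and drops the local copies.

## The line: CONSERVATION LAW + NO EXCESS, the conservation law by EULER SYSTEM + MIXED NOETHER

(Unchanged from the strategist's `Lines/euler-noether.md`.) Write `a' = a(u_i v, u_i)/u_iᵖ` for the
controlled transform in chart `i`, `E ≅ ℙⁿ⁻¹` for the exceptional divisor, `F = a_p`, `G = a_{p+1}`.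
Characteristic `p` gives `d(u_iᵖ a') = u_iᵖ · d a'` (the Jacobian ideal of the successor is a GLOBAL
ideal on the blow-up, its zeros on `E` are `V(∂₁F, …, ∂ₙF, G)`) and `∂_{u_i}(u_i⁻ᵖ ã) = u_i⁻ᵖ ∂_{u_i} ã`
(in chart `i` the Jacobian ideal of the successor is the MIXED TRANSFORM, weights `(p-1,…,p-1,p+1)`, of
the EULER SYSTEM `(∂_j a (j ≠ i), θa)`, `θ = Σ u_j ∂_j` — stub S3). Polar additivity (S4) and Max
Noether in dimension `n` for mixed transforms (S5) turn the global count into local algebra (S6: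
`Σ_Q μ_Q(a') + Δ_n(p) = μ(a)` under no excess); no excess (S2) is forced by an isolated multiplicity-`p`
successor; base change (S1) moves everything to `κ̄`; the curve case `n = 1` (S7) is explicit.

## Stubs (7 = stubs_max): S7 singleStepN1 · S1 baseChange · S2 noExcess · S3 eulerTransform ·
## S4 polarAdditivity · S5 mixedNoether · S6 budgetOfEngines.  Composition `IsolatedJacobianDrop_of`
## and `IsolatedJacobianDrop_proof` are sorry-free apart from the stubs.

Disproof used (`Cruxes/IsolatedJacobianDrop/Disproof.lean` v2, cdisprove cycle 1): `MultP (run m)` and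
`Isol (run m)` load-bearing (both are hypotheses of S2/S6/S7), `Isol (run (m+1))` formally droppable,
`PerfectField` unused by the conservation law, tight at `n = 1` (S7 is an equality `μ' + p = μ`), all six
original stubs audited TRUE AS TYPED (§5); no `-- Targets` served yet.
-/

-- single-problem summit: the doubled namespace component `ResolutionOfSingularities` is forced
set_option linter.dupNamespace false

noncomputable section

open scoped BigOperators Classical

open Summit.ResolutionOfSingularities.ResolutionOfSingularities.Theses.JacobianBudget (IsolatedJacobianDrop)
open Summit.ResolutionOfSingularities.ResolutionOfSingularities.Theorems.WildCones
  (clean bl ord dv tr step run ser pd jac Isol MultP mu)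

namespace Summit.ResolutionOfSingularities.ResolutionOfSingularities.Theorems.JacobianBudget

/-! ## New vocabulary of the line (local copies; to be `Theorems/JacobianBudgetDefs.lean`) -/

section Vocabulary
variable {n : ℕ} {κ : Type} [Field κ]

/-- the universal decrement `Δ_n(p) = ((p-1)^n (p+1) - (-1)^n)/p` (`Δ₁ = p`, `Δ₂ = p² - p - 1`,
`Δ₃(3) = 11`, `Δ₄(3) = 21`, `Δ₃(5) = 77`), verbatim the crux's `let Δ`. [folklore] -/
def Δ (p n : ℕ) : ℕ := ((p - 1) ^ n * (p + 1) + 1 - 2 * ((n + 1) % 2)) / p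

/-- coefficient function of a power series. [folklore] -/
def toFun (f : MvPowerSeries (Fin n) κ) : (Fin n → ℕ) → κ :=
  fun A => f (Finsupp.equivFunOnFinite.symm A)

/-- power series of a coefficient function. [folklore] -/
def ofFun (c : (Fin n → ℕ) → κ) : MvPowerSeries (Fin n) κ :=
  show MvPowerSeries (Fin n) κ from fun A : Fin n →₀ ℕ => c ⇑A

/-- the degree-`d` homogeneous form of the cleaned state, as a polynomial in the `n` coordinates
(`form p p c = F`, the tangent form; `form p (p+1) c = G`). [folklore] -/
def form (p d : ℕ) (c : (Fin n → ℕ) → κ) : MvPolynomial (Fin n) κ :=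
  ∑ A ∈ Finset.Nat.antidiagonalTuple n d,
    MvPolynomial.monomial (Finsupp.equivFunOnFinite.symm A) (clean p n κ c A)

/-- the EXCEPTIONAL CRITICAL IDEAL `(∂₁F, …, ∂ₙF, G)`: its projective zero set in `E ≅ ℙⁿ⁻¹` is the zero
locus on the exceptional divisor of `d a'`. [folklore] -/
def excIdeal (p : ℕ) (c : (Fin n → ℕ) → κ) : Ideal (MvPolynomial (Fin n) κ) :=
  Ideal.span (insert (form p (p + 1) c) (Set.range fun i => MvPolynomial.pderiv i (form p p c)))

/-- NO-EXCESS predicate: the projective zero set of `excIdeal` is finite — chart by chart, every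
dehomogenisation `x_j = 1` is a finite-dimensional algebra. [folklore] -/
def ExcFinite (p : ℕ) (c : (Fin n → ℕ) → κ) : Prop :=
  ∀ j : Fin n, Module.Finite κ
    (MvPolynomial (Fin n) κ ⧸ (excIdeal p c ⊔ Ideal.span {MvPolynomial.X j - 1}))

/-- homogeneous coordinates of the exceptional point presented as (chart `q.1`, translation `q.2`):
`[τ₁ : … : 1 (slot q.1) : … : τₙ]`. [folklore] -/
def pt (q : Fin n × (Fin n → κ)) : Fin n → κ := Function.update q.2 q.1 1

/-- NORMAL FORM of an exceptional point: its chart is the LAST nonzero homogeneous coordinate, so the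
translation vanishes at and after the chart index (unique presentation of each point of `E(κ)`). [folklore] -/
def NF (q : Fin n × (Fin n → κ)) : Prop := ∀ i, q.1 ≤ i → q.2 i = 0

/-- the `k`-controlled transform `u^{-k} f̃` of a power series `f` of order `≥ k` at the exceptional point
`q`, as a power series in the chart coordinates centred at `q` (Taylor expansion = `tr`, exact). [folklore] -/
def locT (q : Fin n × (Fin n → κ)) (k : ℕ) (f : MvPowerSeries (Fin n) κ) : MvPowerSeries (Fin n) κ :=
  ofFun (tr n κ q.1 q.2 k (dv n κ q.1 k (bl n κ q.1 (toFun f))))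

end Vocabulary

/-! ## The one-step form of the crux and the definitional bridge -/

/-- ONE-STEP DROP over the named calculus (equivalent to the crux: every `(c, i, τ)` is a run of
length one, and `run (m+1) = step (i m) (t m) (run m)` definitionally). Internal node, NOT a stub. [folklore] -/
def SingleStepDrop : Prop :=
  ∀ p : ℕ, p.Prime → ∀ n : ℕ, 0 < n → ∀ (κ : Type) [Field κ] [CharP κ p] [PerfectField κ]
    (c : (Fin n → ℕ) → κ) (i : Fin n) (τ : Fin n → κ),
    Isol p n κ c → MultP p n κ c → Isol p n κ (step p n κ i τ c) → MultP p n κ (step p n κ i τ c) →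
      mu p n κ (step p n κ i τ c) + Δ p n ≤ mu p n κ c

/-! ## The stub STATEMENTS as named propositions -/

/-- **S7 · the curve case `n = 1` (base of the induction; provable now).** For `n = 1`, `bl` and `tr`
are the identity, a cleaned series `Σ c_k u^k` (`p ∤ k`) of order `d ≥ p` (so `d ≥ p + 1`) has
`μ = d - 1`, the step divides by `u^p` and re-cleans nothing, so `μ' = d - p - 1`: the drop is EXACTLY
`p = Δ_1(p)` (the sibling's `WildCones.stub_muDropCurve` computes both colengths; the tree's
`Negative/TightN1.lean` is the instance `u⁵ ↦ u³`, `p = 2`). [folklore] -/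
def SingleStepN1 : Prop :=
  ∀ p : ℕ, p.Prime → ∀ (κ : Type) [Field κ] [CharP κ p] [PerfectField κ]
    (c : (Fin 1 → ℕ) → κ) (i : Fin 1) (τ : Fin 1 → κ),
    Isol p 1 κ c → MultP p 1 κ c → Isol p 1 κ (step p 1 κ i τ c) → MultP p 1 κ (step p 1 κ i τ c) →
      mu p 1 κ (step p 1 κ i τ c) + p ≤ mu p 1 κ c

/-- **S1 · base change.** `Isol`, `MultP`, `mu` are invariant under extension of the ground field and
`step` commutes with it (`clean`, `bl`, `dv`, `tr` are coefficientwise; an ideal of `κ[[u]]` of finite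
colength contains `𝔪^N`, truncate and tensor). [folklore] -/
def BaseChange : Prop :=
  ∀ (p n : ℕ) (κ L : Type) [Field κ] [Field L] [Algebra κ L]
    (c : (Fin n → ℕ) → κ) (i : Fin n) (τ : Fin n → κ),
    (Isol p n κ c ↔ Isol p n L (fun A => algebraMap κ L (c A))) ∧
    (MultP p n κ c ↔ MultP p n L (fun A => algebraMap κ L (c A))) ∧
    mu p n κ c = mu p n L (fun A => algebraMap κ L (c A)) ∧
    (fun A => algebraMap κ L (step p n κ i τ c A)) =
      step p n L i (fun j => algebraMap κ L (τ j)) (fun A => algebraMap κ L (c A))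

/-- **S2 · no excess (projective geometry of the tangent form + Krull at the cone vertex).** Over an
algebraically closed field of characteristic `p`: if `c` is isolated of multiplicity `p` and its
successor at the exceptional point `(i, τ)` is again isolated of multiplicity `p`, then the exceptional
critical scheme `V(∂₁F, …, ∂ₙF, G) ⊂ ℙⁿ⁻¹` of `c` is finite. [folklore] -/
def NoExcess : Prop :=
  ∀ p : ℕ, p.Prime → ∀ n : ℕ, 0 < n → ∀ (L : Type) [Field L] [CharP L p] [IsAlgClosed L]
    (c : (Fin n → ℕ) → L) (i : Fin n) (τ : Fin n → L),
    Isol p n L c → MultP p n L c → Isol p n L (step p n L i τ c) → MultP p n L (step p n L i τ c) →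
      ExcFinite p c

/-- **The EXCEPTIONAL BUDGET (conservation law, inequality form).** Over an algebraically closed field of
characteristic `p`: if `c` is isolated of multiplicity `p` with finite exceptional critical scheme, then
for every finite set `S` of pairwise distinct exceptional points (any chart/translation presentation)
`Σ_{Q ∈ S} μ(step_Q c) + Δ_n(p) ≤ μ(c)`. The expected truth is the EQUALITY over all `Q ∈ E`.
Target of `stub_budgetOfEngines`. [folklore] -/
def ExceptionalBudget : Prop :=
  ∀ p : ℕ, p.Prime → ∀ n : ℕ, 0 < n → ∀ (L : Type) [Field L] [CharP L p] [IsAlgClosed L]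
    (c : (Fin n → ℕ) → L), Isol p n L c → MultP p n L c → ExcFinite p c →
    ∀ S : Finset (Fin n × (Fin n → L)),
      (S : Set (Fin n × (Fin n → L))).Pairwise (fun q q' => ∀ l : L, pt q' ≠ l • pt q) →
      (∑ q ∈ S, mu p n L (step p n L q.1 q.2 c)) + Δ p n ≤ mu p n L c

/-- **S3 · the Euler transform identity (FIRST LEMMA; provable now).** In characteristic `p`, for a state
of multiplicity `p` and the AXIS successor of chart `i` (`τ = 0`): for `j ≠ i` the `j`-th partial of the
successor is the `(p-1)`-controlled transform of `∂_j a`, and the `i`-th partial is the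
`(p+1)`-controlled transform of the Euler derivative `θa = Σ_j u_j ∂_j a`. Coefficientwise both sides are
`(B_j+1)·[Σ_{k≠i}B_k ≤ B_i+p-1]·clean c (A)`, resp. `(B_i+1) ≡ |A| (mod p)` with `|A| = B_i+p+1`. [folklore] -/
def EulerTransform : Prop :=
  ∀ p : ℕ, p.Prime → ∀ n : ℕ, 0 < n → ∀ (L : Type) [Field L] [CharP L p]
    (c : (Fin n → ℕ) → L) (i : Fin n), MultP p n L c →
    (∀ j, j ≠ i →
      pd n L j (ser p n L (step p n L i 0 c)) =
        show MvPowerSeries (Fin n) L from fun A : Fin n →₀ ℕ =>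
          dv n L i (p - 1) (bl n L i (fun B => pd n L j (ser p n L c) (Finsupp.equivFunOnFinite.symm B))) ⇑A) ∧
    pd n L i (ser p n L (step p n L i 0 c)) =
      show MvPowerSeries (Fin n) L from fun A : Fin n →₀ ℕ =>
        dv n L i (p + 1) (bl n L i (fun B => (∑ j, MvPowerSeries.X j * pd n L j (ser p n L c) : MvPowerSeries (Fin n) L)
          (Finsupp.equivFunOnFinite.symm B))) ⇑A

/-- **S4 · polar additivity (Lê–Teissier shape; commutative algebra of complete intersections).** In
`R = L[[u₁, …, uₙ]]`, for `k < n` series `g₁, …, g_k` and `x, y` with `R ⧸ (g, x)` and `R ⧸ (g, y)`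
finite over `L`: `dim_L R ⧸ (g, x·y) = dim_L R ⧸ (g, x) + dim_L R ⧸ (g, y)` (vacuous unless
`k = n - 1` by Krull — tree: `SopRegular.ringKrullDim_le_length_of_maximalIdeal_pow_le`; then `(g, x)`
is a system of parameters of the regular local ring `R`, hence a regular sequence —
tree: `SopRegular.isRegular_of_maximalIdeal_pow_le_ofList` — and
`0 → R⧸(g,y) →·x R⧸(g,xy) → R⧸(g,x) → 0` is exact; tree: `ColengthFinrank.finrank_quotient_eq_colon_add`). [folklore] -/
def PolarAdditivity : Prop :=
  ∀ (n k : ℕ), k < n → ∀ (L : Type) [Field L]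
    (g : Fin k → MvPowerSeries (Fin n) L) (x y : MvPowerSeries (Fin n) L),
    Module.Finite L (MvPowerSeries (Fin n) L ⧸ (Ideal.span (Set.range g) ⊔ Ideal.span {x})) →
    Module.Finite L (MvPowerSeries (Fin n) L ⧸ (Ideal.span (Set.range g) ⊔ Ideal.span {y})) →
    Module.finrank L (MvPowerSeries (Fin n) L ⧸ (Ideal.span (Set.range g) ⊔ Ideal.span {x * y})) =
      Module.finrank L (MvPowerSeries (Fin n) L ⧸ (Ideal.span (Set.range g) ⊔ Ideal.span {x})) +
      Module.finrank L (MvPowerSeries (Fin n) L ⧸ (Ideal.span (Set.range g) ⊔ Ideal.span {y}))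

/-- **S5 · MAX NOETHER IN DIMENSION `n` FOR MIXED TRANSFORMS (the intersection-theoretic heart).** Over an
algebraically closed field `L`, in `R = L[[u₁, …, uₙ]]`: let `f₁, …, fₙ` generate an ideal of finite
colength, `k_i ≤ ord f_i`, and suppose the `k`-controlled transforms `u^{-k_i} f̃_i` on the blow-up of
the closed point have only finitely many common zeros on `E ≅ ℙⁿ⁻¹` — listed without repetition, in
normal form, by `S` (every normal-form point outside `S` is a non-zero of some transform). Then
`dim_L R ⧸ (f) = k₁⋯kₙ + Σ_{Q ∈ S} dim_L L[[v]] ⧸ (transforms at Q)` (Fulton, Intersection Theory,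
Ex. 12.4.8 (a); `n = 2` is Noether's formula plus additivity). [folklore] -/
def MixedNoether : Prop :=
  ∀ n : ℕ, 0 < n → ∀ (L : Type) [Field L] [IsAlgClosed L]
    (f : Fin n → MvPowerSeries (Fin n) L) (k : Fin n → ℕ),
    Module.Finite L (MvPowerSeries (Fin n) L ⧸ Ideal.span (Set.range f)) →
    (∀ i (A : Fin n →₀ ℕ), f i A ≠ 0 → k i ≤ A.sum (fun _ e => e)) →
    ∀ S : Finset (Fin n × (Fin n → L)),
      (∀ q ∈ S, NF q) →
      (∀ q, NF q → q ∉ S → Ideal.span (Set.range fun i => locT q (k i) (f i)) = ⊤) →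
      Module.finrank L (MvPowerSeries (Fin n) L ⧸ Ideal.span (Set.range f)) =
        (∏ i, k i) +
          ∑ q ∈ S, Module.finrank L
            (MvPowerSeries (Fin n) L ⧸ Ideal.span (Set.range fun i => locT q (k i) (f i)))

/-! ## The stub statements BY STUB NAME (`Sig.stub_<name>`; the skeleton audit admits a hypothesis of
the composition only when its head constant carries the stub's name) -/

/-- statement of `stub_singleStepN1`. [folklore] -/
abbrev Sig.stub_singleStepN1 : Prop := SingleStepN1
/-- statement of `stub_baseChange`. [folklore] -/
abbrev Sig.stub_baseChange : Prop := BaseChange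
/-- statement of `stub_noExcess`. [folklore] -/
abbrev Sig.stub_noExcess : Prop := NoExcess
/-- statement of `stub_eulerTransform`. [folklore] -/
abbrev Sig.stub_eulerTransform : Prop := EulerTransform
/-- statement of `stub_polarAdditivity`. [folklore] -/
abbrev Sig.stub_polarAdditivity : Prop := PolarAdditivity
/-- statement of `stub_mixedNoether`. [folklore] -/
abbrev Sig.stub_mixedNoether : Prop := MixedNoether
/-- statement of `stub_budgetOfEngines`: the exceptional budget from the three engines. [folklore] -/
abbrev Sig.stub_budgetOfEngines : Prop := EulerTransform → PolarAdditivity → MixedNoether → ExceptionalBudget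

/-! ## The stubs -/

/-- **Stub S7 (S, provable now): the curve case `n = 1`.** See `SingleStepN1`. [folklore] -/
theorem stub_singleStepN1 :
    ∀ p : ℕ, p.Prime → ∀ (κ : Type) [Field κ] [CharP κ p] [PerfectField κ]
      (c : (Fin 1 → ℕ) → κ) (i : Fin 1) (τ : Fin 1 → κ),
      Isol p 1 κ c → MultP p 1 κ c → Isol p 1 κ (step p 1 κ i τ c) → MultP p 1 κ (step p 1 κ i τ c) →
        mu p 1 κ (step p 1 κ i τ c) + p ≤ mu p 1 κ c := by
  sorry

/-- **Stub S1 (M): base change.** See `BaseChange`. [folklore] -/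
theorem stub_baseChange :
    ∀ (p n : ℕ) (κ L : Type) [Field κ] [Field L] [Algebra κ L]
      (c : (Fin n → ℕ) → κ) (i : Fin n) (τ : Fin n → κ),
      (Isol p n κ c ↔ Isol p n L (fun A => algebraMap κ L (c A))) ∧
      (MultP p n κ c ↔ MultP p n L (fun A => algebraMap κ L (c A))) ∧
      mu p n κ c = mu p n L (fun A => algebraMap κ L (c A)) ∧
      (fun A => algebraMap κ L (step p n κ i τ c A)) =
        step p n L i (fun j => algebraMap κ L (τ j)) (fun A => algebraMap κ L (c A)) := by
  sorry

/-- **Stub S2 (M/L): no excess.** See `NoExcess` and the module docstring. [folklore] -/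
theorem stub_noExcess :
    ∀ p : ℕ, p.Prime → ∀ n : ℕ, 0 < n → ∀ (L : Type) [Field L] [CharP L p] [IsAlgClosed L]
      (c : (Fin n → ℕ) → L) (i : Fin n) (τ : Fin n → L),
      Isol p n L c → MultP p n L c → Isol p n L (step p n L i τ c) → MultP p n L (step p n L i τ c) →
        ExcFinite p c := by
  sorry

/-- **Stub S3 (S/M, provable now; the first lemma): the Euler transform identity.** See `EulerTransform`. [folklore] -/
theorem stub_eulerTransform :
    ∀ p : ℕ, p.Prime → ∀ n : ℕ, 0 < n → ∀ (L : Type) [Field L] [CharP L p]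
      (c : (Fin n → ℕ) → L) (i : Fin n), MultP p n L c →
      (∀ j, j ≠ i →
        pd n L j (ser p n L (step p n L i 0 c)) =
          show MvPowerSeries (Fin n) L from fun A : Fin n →₀ ℕ =>
            dv n L i (p - 1) (bl n L i (fun B => pd n L j (ser p n L c) (Finsupp.equivFunOnFinite.symm B))) ⇑A) ∧
      pd n L i (ser p n L (step p n L i 0 c)) =
        show MvPowerSeries (Fin n) L from fun A : Fin n →₀ ℕ =>
          dv n L i (p + 1) (bl n L i (fun B => (∑ j, MvPowerSeries.X j * pd n L j (ser p n L c) : MvPowerSeries (Fin n) L)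
            (Finsupp.equivFunOnFinite.symm B))) ⇑A := by
  sorry

/-- **Stub S4 (M): polar additivity.** See `PolarAdditivity`. [folklore] -/
theorem stub_polarAdditivity :
    ∀ (n k : ℕ), k < n → ∀ (L : Type) [Field L]
      (g : Fin k → MvPowerSeries (Fin n) L) (x y : MvPowerSeries (Fin n) L),
      Module.Finite L (MvPowerSeries (Fin n) L ⧸ (Ideal.span (Set.range g) ⊔ Ideal.span {x})) →
      Module.Finite L (MvPowerSeries (Fin n) L ⧸ (Ideal.span (Set.range g) ⊔ Ideal.span {y})) →
      Module.finrank L (MvPowerSeries (Fin n) L ⧸ (Ideal.span (Set.range g) ⊔ Ideal.span {x * y})) =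
        Module.finrank L (MvPowerSeries (Fin n) L ⧸ (Ideal.span (Set.range g) ⊔ Ideal.span {x})) +
        Module.finrank L (MvPowerSeries (Fin n) L ⧸ (Ideal.span (Set.range g) ⊔ Ideal.span {y})) := by
  sorry

/-- **Stub S5 (L/XL, hardest infrastructure): Max Noether in dimension `n` for mixed transforms.** See
`MixedNoether`. [folklore] -/
theorem stub_mixedNoether :
    ∀ n : ℕ, 0 < n → ∀ (L : Type) [Field L] [IsAlgClosed L]
      (f : Fin n → MvPowerSeries (Fin n) L) (k : Fin n → ℕ),
      Module.Finite L (MvPowerSeries (Fin n) L ⧸ Ideal.span (Set.range f)) →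
      (∀ i (A : Fin n →₀ ℕ), f i A ≠ 0 → k i ≤ A.sum (fun _ e => e)) →
      ∀ S : Finset (Fin n × (Fin n → L)),
        (∀ q ∈ S, NF q) →
        (∀ q, NF q → q ∉ S → Ideal.span (Set.range fun i => locT q (k i) (f i)) = ⊤) →
        Module.finrank L (MvPowerSeries (Fin n) L ⧸ Ideal.span (Set.range f)) =
          (∏ i, k i) +
            ∑ q ∈ S, Module.finrank L
              (MvPowerSeries (Fin n) L ⧸ Ideal.span (Set.range fun i => locT q (k i) (f i))) := by
  sorry

/-- **Stub S6 (L, the argument): the exceptional budget from the three engines.** See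
`ExceptionalBudget` and the strategist's plan v2 in `Lines/euler-noether.md` (induction on `n`; generic
hyperplane; Euler system + shears; boundary identity; polar additivity; `(p-1)ⁿ⁻¹(p+1) − Δ_{n-1}(p) = Δ_n(p)`).
A direct proof of `ExceptionalBudget` also closes this stub, ignoring the engines. [folklore] -/
theorem stub_budgetOfEngines :
    EulerTransform → PolarAdditivity → MixedNoether → ExceptionalBudget := by
  sorry

/-! ## The composition (sorry-free): stubs ⇒ one-step drop ⇒ the crux BY NAME -/

/-- `Δ_1(p) = p`. [folklore] -/
theorem Δ_one (p : ℕ) (hp : p.Prime) : Δ p 1 = p := by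
  unfold Δ
  have h2 : 2 ≤ p := hp.two_le
  have h : (p - 1) ^ 1 * (p + 1) + 1 - 2 * ((1 + 1) % 2) = p * p := by
    rw [pow_one]
    obtain ⟨q, rfl⟩ : ∃ q, p = q + 1 := ⟨p - 1, by omega⟩
    simp
    ring
  rw [h, Nat.mul_div_cancel _ hp.pos]

/-- curve case + base change + no excess + exceptional budget ⇒ the one-step drop over every perfect
field (`n = 1` by S7 directly; `n ≥ 2` by extension of scalars to `κ̄`, no excess, and the budget at
the single exceptional point). [folklore] -/
theorem singleStep_of (h1 : SingleStepN1) (hBC : BaseChange) (hNE : NoExcess) (hB : ExceptionalBudget) :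
    SingleStepDrop := by
  intro p hp n hn κ _ _ _ c i τ hI hM hI' hM'
  -- the curve case is S7
  by_cases hn1 : n = 1
  · subst hn1
    rw [Δ_one p hp]
    exact h1 p hp κ c i τ hI hM hI' hM'
  -- extend scalars to the algebraic closure
  haveI : CharP (AlgebraicClosure κ) p :=
    charP_of_injective_algebraMap (algebraMap κ (AlgebraicClosure κ)).injective p
  obtain ⟨hIso, hMul, hmu, hstep⟩ := hBC p n κ (AlgebraicClosure κ) c i τ
  obtain ⟨hIso2, hMul2, hmu2, -⟩ := hBC p n κ (AlgebraicClosure κ) (step p n κ i τ c) i τ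
  have hI1 := hIso.mp hI
  have hM1 := hMul.mp hM
  have hI2 := hIso2.mp hI'
  have hM2 := hMul2.mp hM'
  rw [hstep] at hI2 hM2
  have hEF := hNE p hp n hn (AlgebraicClosure κ) _ i _ hI1 hM1 hI2 hM2
  have key := hB p hp n hn (AlgebraicClosure κ) _ hI1 hM1 hEF
    {(i, fun j => algebraMap κ (AlgebraicClosure κ) (τ j))} (by simp)
  rw [Finset.sum_singleton] at key
  rw [hmu, hmu2, hstep]
  exact key

/-- **`IsolatedJacobianDrop` from the seven stub STATEMENTS (by stub name) — kernel-checked, no `sorry`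
in its closure.** The crux's fourteen `let`s are the `WildCones` definitions verbatim, so after `intro`
the identification with `SingleStepDrop` at `(run m, i m, t m)` is definitional. [folklore] -/
theorem IsolatedJacobianDrop_of :
    Sig.stub_singleStepN1 → Sig.stub_baseChange → Sig.stub_noExcess → Sig.stub_eulerTransform →
      Sig.stub_polarAdditivity → Sig.stub_mixedNoether → Sig.stub_budgetOfEngines →
        IsolatedJacobianDrop := by
  intro h1 hBC hNE hET hPA hMN hBE
  intro p hp n hn κ _ _ _ c₀ i t clean' bl' ord' dv' tr' step' run' ser' pd' jac' Isol' MultP' mu' Δ' m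
    k1 k2 k3 k4
  exact singleStep_of h1 hBC hNE (hBE hET hPA hMN) p hp n hn κ (run p n κ c₀ i t m) (i m) (t m) k1 k2 k3 k4

/-- **The crux, assembled from the seven registered stubs** (the only `sorry`s in its closure are the
`stub_*`). -/
theorem IsolatedJacobianDrop_proof : IsolatedJacobianDrop :=
  IsolatedJacobianDrop_of stub_singleStepN1 stub_baseChange stub_noExcess stub_eulerTransform
    stub_polarAdditivity stub_mixedNoether stub_budgetOfEngines

end Summit.ResolutionOfSingularities.ResolutionOfSingularities.Theorems.JacobianBudget

end
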